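import Summits.Ventures.QEC.Theorems.BB144DistanceCertificateLowerZKernel
import Summits.Ventures.QEC.Theorems.BB144DistanceCertificateTwelveLogicalQubits144
import Summits.Ventures.QEC.Census.CertBZInfoSets
import Summits.Ventures.QEC.Census.BB.BB144.BZPlaneEnumZ00
import Summits.Ventures.QEC.Census.BB.BB144.BZPlaneEnumZ01
import Summits.Ventures.QEC.Census.BB.BB144.BZPlaneEnumZ02
import Summits.Ventures.QEC.Census.BB.BB144.BZPlaneEnumZ03
import Summits.Ventures.QEC.Census.BB.BB144.BZPlaneEnumZ04
import Summits.Ventures.QEC.Census.BB.BB144.BZPlaneEnumZ05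
import Summits.Ventures.QEC.Census.BB.BB144.BZPlaneEnumZ06
import Summits.Ventures.QEC.Census.BB.BB144.BZPlaneEnumZ07
import Summits.Ventures.QEC.Census.BB.BB144.BZPlaneEnumZ08
import Summits.Ventures.QEC.Census.BB.BB144.BZPlaneEnumZ09
import Summits.Ventures.QEC.Census.BB.BB144.BZPlaneEnumZ10
import Summits.Ventures.QEC.Census.BB.BB144.BZPlaneEnumZ11
import Summits.Ventures.QEC.Census.BB.BB144.BZPlaneEnumZ12
import Summits.Ventures.QEC.Census.BB.BB144.BZPlaneEnumZ13
import Summits.Ventures.QEC.Census.BB.BB144.BZPlaneEnumZ14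
import Summits.Ventures.QEC.Census.BB.BB144.BZAutInfoSetsZ1
import Summits.Ventures.QEC.Census.BB.BB144.BZAutBoundsZ
import Summits.Ventures.QEC.Theses.BB144DistanceCertificate
import HarnessLib

/-!
# `[[144,12,12]]` at tier KERNEL-std (lane δ — lane-parallel block verdicts): `bb144_twelve_le_flat_std` and
# `BB144_kernel_std : NoZLogicalBelowTwelve ∧ Target ∧ BB144_12_12_claim`, axioms ⊆ {propext, Classical.choice, Quot.sound}

The items of route BB144DistanceCertificate are CLOSED at tier CHECKED-native (`noZLogicalBelowTwelve_proof`,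
`target144_proof`, `BB144_12_12_claim_holds`, qec-type-10 — through `native_decide` enumeration verdicts). This file
is the KERNEL-std re-derivation ruled in director-qec R21/R23: the fifteen representative blocks of the `bz_aut`
certificate `7c1e929a…` are certified by the lane-parallel replay (`Census/CertBZPlane*.lean`, qec-type-01; verdicts
`enumZk_b : cert.bzZEnum bzAutData b 0 = true ∧ cert.bzZEnum bzAutData b 1 = true` in
`Census/BB/BB144/BZPlaneEnumZ00 … 14.lean`, every segment `decide +kernel`; blocks 8–14 filed by qec-search-10 as
second hand) together with qec-search-7's KERNEL information sets `autSysZ_b_i` and bounds `autBoundZ_b`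
(`DistCert.bzZBlock_of_parts`); `twelve_le_flat_of_blocks` (qec-type-10, `Theorems/BB144DistanceCertificateLowerZKernel.lean`:
qec-type-12's tabulated KERNEL label cover `coverAutTabOK_bb144`, the 72 translation transports of type-07/type-12)
gives the flat bound (B); type-05's `BB.Code.zLowerBound_of_flat`, the route's `closes`, type-10's weight-12 witness
`weightTwelveZLogical_proof` and type-02's `TwelveLogicalQubits144_proof` give (A).

STATEMENT SHAPE (R23, the gate's dedup wall): the standard-axiom twins cannot restate `NoZLogicalBelowTwelve` /
`Target` / `BB144_12_12_claim` alone (statement-identical to the landed native theorems ⇒ `dedup.landed`), so (A) is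
ONE theorem whose type is the conjunction, conjunct 3 spelled exactly `Summit.Ventures.QEC.BB.BB144_12_12_claim`;
the projections are definitional and add no axiom.
-/

namespace Summit.Ventures.QEC.Census.BB144

open Matrix Literature.InformationTheory.QuantumCodes Literature.InformationTheory.QuantumCodes.BB
  Summit.Ventures.QEC.BB Summit.Ventures.QEC.Theses.BB144DistanceCertificate

/-- **(B) The flat lower bound at tier KERNEL-std**: every vector in `ker H_X ∖ rowspace H_Z` of the typed gross
code's flat matrices `BB.bb144.HXFlat / HZFlat` has Hamming weight `≥ 12` — from the fifteen KERNEL block verdicts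
(30 information sets, 15 lane-engine enumeration conjunctions, 15 bounds) through `twelve_le_flat_of_blocks`. -/
theorem bb144_twelve_le_flat_std : ∀ w : Fin 144 → ZMod 2,
    BB.bb144.HXFlat *ᵥ w = 0 → w ∉ rowSpace BB.bb144.HZFlat → 12 ≤ hammingNorm w := by
  -- one block from its five KERNEL parts
  have hblk : ∀ (b : ℕ) (blk : BZBlock), bzAutData.sideZ.blocks[b]? = some blk → blk.mats.length = 2 →
      cert.bzZSys bzAutData b 0 = true → cert.bzZSys bzAutData b 1 = true →
      (cert.bzZEnum bzAutData b 0 = true ∧ cert.bzZEnum bzAutData b 1 = true) →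
      cert.bzZBound bzAutData b = true → cert.bzZBlock bzAutData b = true :=
    fun b blk hb hm hs0 hs1 he hbd =>
      cert.bzZBlock_of_parts bzAutData hb hm
        (fun i hi => by
          interval_cases i
          · exact hs0
          · exact hs1)
        (fun i hi => by
          interval_cases i
          · exact he.1
          · exact he.2) hbd
  -- all fifteen representative blocks
  have hblocks : ∀ b : ℕ, b < bzAutData.sideZ.blocks.length → cert.bzZBlock bzAutData b = true := by
    intro b hb
    change b < 15 at hb
    interval_cases b
    · exact hblk 0 bzAutBlockZ0 rfl rfl autSysZ_0_0 autSysZ_0_1 enumZk_0 autBoundZ_0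
    · exact hblk 1 bzAutBlockZ1 rfl rfl autSysZ_1_0 autSysZ_1_1 enumZk_1 autBoundZ_1
    · exact hblk 2 bzAutBlockZ2 rfl rfl autSysZ_2_0 autSysZ_2_1 enumZk_2 autBoundZ_2
    · exact hblk 3 bzAutBlockZ3 rfl rfl autSysZ_3_0 autSysZ_3_1 enumZk_3 autBoundZ_3
    · exact hblk 4 bzAutBlockZ4 rfl rfl autSysZ_4_0 autSysZ_4_1 enumZk_4 autBoundZ_4
    · exact hblk 5 bzAutBlockZ5 rfl rfl autSysZ_5_0 autSysZ_5_1 enumZk_5 autBoundZ_5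
    · exact hblk 6 bzAutBlockZ6 rfl rfl autSysZ_6_0 autSysZ_6_1 enumZk_6 autBoundZ_6
    · exact hblk 7 bzAutBlockZ7 rfl rfl autSysZ_7_0 autSysZ_7_1 enumZk_7 autBoundZ_7
    · exact hblk 8 bzAutBlockZ8 rfl rfl autSysZ_8_0 autSysZ_8_1 enumZk_8 autBoundZ_8
    · exact hblk 9 bzAutBlockZ9 rfl rfl autSysZ_9_0 autSysZ_9_1 enumZk_9 autBoundZ_9
    · exact hblk 10 bzAutBlockZ10 rfl rfl autSysZ_10_0 autSysZ_10_1 enumZk_10 autBoundZ_10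
    · exact hblk 11 bzAutBlockZ11 rfl rfl autSysZ_11_0 autSysZ_11_1 enumZk_11 autBoundZ_11
    · exact hblk 12 bzAutBlockZ12 rfl rfl autSysZ_12_0 autSysZ_12_1 enumZk_12 autBoundZ_12
    · exact hblk 13 bzAutBlockZ13 rfl rfl autSysZ_13_0 autSysZ_13_1 enumZk_13 autBoundZ_13
    · exact hblk 14 bzAutBlockZ14 rfl rfl autSysZ_14_0 autSysZ_14_1 enumZk_14 autBoundZ_14
  intro w hw hw'
  exact twelve_le_flat_of_blocks hblocks w hw hw'

/-- **(A) `[[144,12,12]]` at tier KERNEL-std, packaged**: the route's `NoZLogicalBelowTwelve`, its `Target`, and the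
registered CLAIM `Summit.Ventures.QEC.BB.BB144_12_12_claim` (Bravyi et al., Nature 627 (2024) Table 1:
`[[144, 12, 12]]`), all with axioms ⊆ {propext, Classical.choice, Quot.sound} (conjunction form per director-qec
R23; each conjunct is statement-identical to its CHECKED-native predecessor). -/
theorem BB144_kernel_std :
    Summit.Ventures.QEC.Theses.BB144DistanceCertificate.NoZLogicalBelowTwelve ∧
      Summit.Ventures.QEC.Theses.BB144DistanceCertificate.Target ∧
        Summit.Ventures.QEC.BB.BB144_12_12_claim := by
  have hN : Summit.Ventures.QEC.Theses.BB144DistanceCertificate.NoZLogicalBelowTwelve :=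
    BB.bb144.zLowerBound_of_flat (D := flatCode) HX_eq_flat HZ_eq_flat fun w hw hw' =>
      bb144_twelve_le_flat_std w (by rw [← HX_eq_flat]; exact hw) (by rw [← HZ_eq_flat]; exact hw')
  have hT : Summit.Ventures.QEC.Theses.BB144DistanceCertificate.Target :=
    closes hN weightTwelveZLogical_proof Summit.Ventures.QEC.Theorems.TwelveLogicalQubits144_proof
  exact ⟨hN, hT, hT⟩

end Summit.Ventures.QEC.Census.BB144
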